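import Literature.NumberTheory.EllipticCurves.OpenImageMazurFrobeniusProofs
import Literature.NumberTheory.EllipticCurves.ComplexMultiplicationDeuringFrobeniusProofs
import HarnessLib

/-!
# The character of a rational cyclic subgroup of prime-power order at a good prime:
# `r(φ_ℓ)² − a_ℓ·r(φ_ℓ) + ℓ ≡ 0 (mod pᵏ)`

Topic `Literature/NumberTheory/EllipticCurves`; theorems only (no definition, no named fact).
Prime-power-modulus form of Mazur 1978, Prop. 6.3 (1) at a prime of good reduction — the tree's
`Mazur1978.isogenyCharacter_sq_sub_frobeniusTrace_mul_add_eq_zero` treats a point of PRIME order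
`N`. Here: let `E/ℚ` be an elliptic curve in global minimal form, `p` a prime, `P ∈ E(\bar ℚ)` a
point of exact order `pᵏ` spanning a `Γ_ℚ`-stable cyclic subgroup, with character
`r : Γ_ℚ → (ℤ/pᵏ)ˣ` (`σ P = r(σ) P`), `ℓ ≠ p` a prime of good reduction, `𝔓` a prime of `\bar ℤ`
above `ℓ`, `φ ∈ Γ_ℚ` an arithmetic Frobenius at `𝔓`. Then

  `r(φ)² − a_ℓ·r(φ) + ℓ = 0` in `ℤ/pᵏ`,  `a_ℓ = ℓ + 1 − #Ẽ(𝔽_ℓ)`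

(`cyclicCharacter_sq_sub_frobeniusTrace_mul_add_eq_zero`). In particular a rational cyclic
`pᵏ`-isogeny forces `X² − a_ℓX + ℓ` to have a root modulo `pᵏ` at every good prime `ℓ ≠ p`
(`exists_root_charpoly_mod_of_cyclicCharacter`) — the consumer of the kernel-decided witnesses
`noroot_…` of `RationalIsogenyFrobeniusCertificates*.lean` for Kenku's levels
`121, 289, 361, 1369, 1849, 4489, 26569 = p²`, `45, 63 (∋ 9)`, `81`, `75 (∋ 25)`.

Proof: verbatim the tree's proof of the prime case (reduction map on `p`-primary torsion at the
good place `v ∣ ℓ`, `exists_reduceTorsionHom`; Manin's relation `φ_k² − a φ_k + ℓ = 0` on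
`Ẽ_v(\bar k_v)`, `frobenius_sq_sub_trace_smul_add_card_smul`, pulled back along the injective
reduction map; `P` has order `pᵏ`, so `pᵏ` divides the resulting scalar; transport from the local
Frobenius to `φ` through the inertia group, which fixes `P` by Silverman VII.4.1(a),
`smul_eq_of_mem_inertia_of_nsmul_eq_zero`, as `ℓ ∤ pᵏ`).

## References

* [Mazur1978] B. Mazur, *Rational isogenies of prime degree*, Invent. Math. 44 (1978) 129–162:
  §5 (p. 148, the isogeny character), §6 Prop. 6.3 (1) and its proof (p. 153).
* [SilvermanAEC2009] J. H. Silverman, *The Arithmetic of Elliptic Curves*, 2nd ed., GTM 106: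
  Thm. V.2.3.1, Prop. VII.2.1, VII.3.1(b), VII.4.1(a).
* [Kenku1982] M. A. Kenku, J. Number Theory 15 (1982) 199–202 (the levels `p²`).
-/

noncomputable section

open scoped Classical
open NumberField IsDedekindDomain IsDedekindDomain.HeightOneSpectrum Field WeierstrassCurve

namespace Literature.NumberTheory.EllipticCurves.Mazur1978

/-- The scalar by which `σ` acts on a point `P` of exact order `m` is determined modulo `m`:
if `c • P = P` (`c ∈ ℤ/m`, acting through `c.val`) then `c = 1`. [folklore] -/
theorem eq_one_of_val_smul_eq_of_addOrderOf {F : Type*} [Field F] (W : WeierstrassCurve F)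
    {m : ℕ} [NeZero m] {P : geomPoints W} (hP : addOrderOf P = m) {c : ZMod m}
    (hc : c.val • P = P) : c = 1 := by
  have h1 : ((c.val : ℤ) - 1) • P = 0 := by
    rw [sub_smul, one_smul, natCast_zsmul, hc, sub_self]
  have h2 : (m : ℤ) ∣ (c.val : ℤ) - 1 := by
    have h := addOrderOf_dvd_iff_zsmul_eq_zero.mpr h1
    rwa [hP] at h
  have h3 : ((c.val : ℤ) : ZMod m) - 1 = 0 := by
    have := (ZMod.intCast_zmod_eq_zero_iff_dvd ((c.val : ℤ) - 1) m).mpr h2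
    push_cast at this ⊢
    exact this
  rw [Int.cast_natCast, ZMod.natCast_zmod_val] at h3
  exact sub_eq_zero.mp h3

/-- **The character of a `Γ_ℚ`-stable cyclic subgroup is unramified at a good prime `ℓ ∤ m`**:
the inertia group of a prime `𝔓 ∣ ℓ` of `\bar ℤ` fixes a point `P` of order `m` at a place of good
reduction with `ℓ ∤ m` (Silverman VII.4.1(a)), so `r(τ) = 1` for `τ ∈ I_𝔓`.
[cite: Mazur1978, §6 (p. 152)] -/
theorem cyclicCharacter_eq_one_of_mem_inertia (W : WeierstrassCurve ℚ) [W.IsElliptic]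
    {m : ℕ} [NeZero m] {P : geomPoints W} (hP : addOrderOf P = m)
    {r : absoluteGaloisGroup ℚ →* (ZMod m)ˣ}
    (hr : ∀ σ : absoluteGaloisGroup ℚ, σ • P = ((r σ : (ZMod m)ˣ) : ZMod m).val • P)
    {v : HeightOneSpectrum (𝓞 ℚ)} (hgood : W.HasGoodReductionAt v) (hmv : (m : 𝓞 ℚ) ∉ v.asIdeal)
    {𝔓 : Ideal (GaloisRepresentations.absIntegers (𝓞 ℚ) ℚ)} (h𝔓 : 𝔓 ∈ v.primesAbove)
    {τ : absoluteGaloisGroup ℚ} (hτ : τ ∈ 𝔓.inertia (absoluteGaloisGroup ℚ)) : r τ = 1 := by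
  have hmP : m • P = 0 := by rw [← hP]; exact addOrderOf_nsmul_eq_zero P
  have hfix : τ • P = P := W.smul_eq_of_mem_inertia_of_nsmul_eq_zero hgood hmv h𝔓 hτ hmP
  have hfix' : ((r τ : (ZMod m)ˣ) : ZMod m).val • P = P := by rw [← hr τ]; exact hfix
  exact Units.ext (eq_one_of_val_smul_eq_of_addOrderOf W hP hfix')

/-- **Mazur 1978, Prop. 6.3 (1) at a good prime, prime-power modulus: `r(φ)` is a root of
`X² − a_ℓ X + ℓ` modulo `pᵏ`.** Let `E/ℚ` be an elliptic curve in global minimal form, `p` a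
prime, `P ∈ E(\bar ℚ)` a point of exact order `pᵏ` whose multiples form a `Γ_ℚ`-stable subgroup
with character `r : Γ_ℚ → (ℤ/pᵏ)ˣ` (`σ P = r(σ) P`), `ℓ ≠ p` a prime of good reduction, `𝔓` a
prime of `\bar ℤ` above `ℓ` and `φ ∈ Γ_ℚ` an arithmetic Frobenius at `𝔓`. Then
`r(φ)² − a_ℓ·r(φ) + ℓ = 0` in `ℤ/pᵏ` with `a_ℓ = ℓ + 1 − #Ẽ(𝔽_ℓ)` (Manin's relation
`φ² − a_ℓ φ + ℓ = 0` on `Ẽ_ℓ(\bar 𝔽_ℓ)`, Silverman V.2.3.1(b), transported to the `p`-primary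
torsion by the injective reduction map, VII.3.1(b)). The case `k = 1` is the tree's
`isogenyCharacter_sq_sub_frobeniusTrace_mul_add_eq_zero`.
[cite: Mazur1978, §6 Prop. 6.3 (1) and its proof (p. 153)] -/
theorem cyclicCharacter_sq_sub_frobeniusTrace_mul_add_eq_zero (W : WeierstrassCurve ℚ)
    [W.IsElliptic] [W.IsGloballyMinimal] (p k ℓ : ℕ) [Fact p.Prime] [Fact ℓ.Prime] (hℓp : ℓ ≠ p)
    (hgoodℓ : W.HasGoodReductionAtPrime ℓ) {P : geomPoints W} (hP : addOrderOf P = p ^ k)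
    {r : absoluteGaloisGroup ℚ →* (ZMod (p ^ k))ˣ}
    (hr : ∀ σ : absoluteGaloisGroup ℚ, σ • P = ((r σ : (ZMod (p ^ k))ˣ) : ZMod (p ^ k)).val • P)
    {v : HeightOneSpectrum (𝓞 ℚ)} (hv : (ℓ : 𝓞 ℚ) ∈ v.asIdeal)
    {𝔓 : Ideal (GaloisRepresentations.absIntegers (𝓞 ℚ) ℚ)} (h𝔓 : 𝔓 ∈ v.primesAbove)
    {φ : absoluteGaloisGroup ℚ} (hφ : IsArithFrobAt (𝓞 ℚ) φ 𝔓) :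
    ((r φ : (ZMod (p ^ k))ˣ) : ZMod (p ^ k)) ^ 2
      - (W.frobeniusTrace ℓ : ZMod (p ^ k)) * ((r φ : (ZMod (p ^ k))ˣ) : ZMod (p ^ k))
        + (ℓ : ZMod (p ^ k)) = 0 := by
  have hp : p.Prime := Fact.out
  have hℓ : ℓ.Prime := Fact.out
  haveI : NeZero (p ^ k) := ⟨pow_ne_zero _ hp.ne_zero⟩
  -- Step 0: from the rational prime `ℓ` to the place `v`
  have hvℓ : (Rat.HeightOneSpectrum.primesEquiv v : ℕ) = ℓ := primesEquiv_eq_of_natCast_mem hℓ hv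
  have hgood : W.HasGoodReductionAt v :=
    (hasGoodReductionAtPrime_primesEquiv_iff_holds W v ℓ hvℓ).mp hgoodℓ
  have hpv : (p : 𝓞 ℚ) ∉ v.asIdeal := fun h ↦
    hℓp (hvℓ.symm.trans (primesEquiv_eq_of_natCast_mem hp h))
  have hpkv : ((p ^ k : ℕ) : 𝓞 ℚ) ∉ v.asIdeal := by
    rw [DeuringLadic.natCast_mem_asIdeal_iff v (p ^ k), hvℓ]
    intro hdvd
    exact hℓp ((Nat.prime_dvd_prime_iff_eq hℓ hp).mp (hℓ.dvd_of_dvd_pow hdvd))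
  -- the reduction `Ẽ_v / k_v`, an elliptic curve over the finite field `k_v` with `ℓ` elements
  set kv := IsLocalRing.ResidueField (v.adicCompletionIntegers ℚ) with hkv
  letI : Fintype kv := Fintype.ofFinite kv
  set Wt : WeierstrassCurve kv := W.reductionAt v with hWt
  haveI : Wt.IsElliptic := isElliptic_reductionAt hgood
  have hcardk : Fintype.card kv = ℓ := by
    rw [← Nat.card_eq_fintype_card, natCard_residueField_adicCompletionIntegers v, hvℓ]
  have hcardWt : Nat.card Wt.toAffine.Point = W.reductionPointCount ℓ := by
    rw [← hvℓ]
    exact natCard_point_reduction_minimal_baseChange v W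
  have htr : HasseManin.tr Wt = W.frobeniusTrace ℓ := by
    rw [HasseManin.tr, hcardk, hcardWt, frobeniusTrace]
  -- Step 1: the reduction map on `p`-primary torsion along `ι`, for a local Frobenius `σ_v`
  obtain ⟨𝔐, h𝔐⟩ := v.localPrimesAbove_nonempty
  let ι : AlgebraicClosure ℚ →ₐ[ℚ] AlgebraicClosure (v.adicCompletion ℚ) :=
    closureEmb (K := ℚ) (v.adicCompletion ℚ)
  obtain ⟨σL, hσL⟩ := v.exists_isArithFrobAt_localAbsIntegers h𝔐
  obtain ⟨φk, hφk⟩ := exists_frobenius_absoluteGaloisGroup kv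
  obtain ⟨f, hf, hfσ⟩ := exists_reduceTorsionHom hpv hgood h𝔐 ι hσL hφk
  set σ₀ : absoluteGaloisGroup ℚ := resGalOfEmb ι σL with hσ₀
  -- the point `P` as an element of `E[p^∞]`
  have hpkP : (p ^ k) • P = 0 := by rw [← hP]; exact addOrderOf_nsmul_eq_zero P
  obtain ⟨P', hP'⟩ : ∃ P' : geomPrimaryTorsion W p, (P' : geomPoints W) = P :=
    ⟨⟨P, k, hpkP⟩, rfl⟩
  -- Step 2: Manin's relation at `f P'`, pulled back along `f`
  have hmanin := Wt.frobenius_sq_sub_trace_smul_add_card_smul hφk (f P')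
  rw [htr, hcardk, ← hfσ, ← hfσ, ← map_zsmul, ← map_zsmul, ← map_sub, ← map_add,
    ← f.map_zero] at hmanin
  have hrel : σ₀ • (σ₀ • P') - W.frobeniusTrace ℓ • (σ₀ • P') + (ℓ : ℤ) • P' = 0 := hf hmanin
  -- in `E(\bar ℚ)`: `σ₀ P = ρ P` with `ρ = r(σ₀).val`
  set ρ : ℕ := ((r σ₀ : (ZMod (p ^ k))ˣ) : ZMod (p ^ k)).val with hρ
  have hσ₀P : σ₀ • P = ρ • P := hr σ₀
  have hrel' : ((ρ : ℤ) ^ 2 - W.frobeniusTrace ℓ * ρ + ℓ) • P = 0 := by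
    have h := congrArg Subtype.val hrel
    simp only [AddSubgroupClass.coe_sub, AddMemClass.coe_add, primaryComponent.coe_smul,
      ZeroMemClass.coe_zero, hP'] at h
    rw [hσ₀P, smul_comm σ₀ ρ P, hσ₀P] at h
    simp only [add_smul, sub_smul, sq, mul_smul, natCast_zsmul]
    exact h
  -- `P` has order `p^k`, so `p^k` divides the scalar
  have hdvd : ((p ^ k : ℕ) : ℤ) ∣ (ρ : ℤ) ^ 2 - W.frobeniusTrace ℓ * ρ + ℓ := by
    rw [← hP]
    exact addOrderOf_dvd_iff_zsmul_eq_zero.mpr hrel'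
  have hzero : (((ρ : ℤ) ^ 2 - W.frobeniusTrace ℓ * ρ + ℓ : ℤ) : ZMod (p ^ k)) = 0 :=
    (ZMod.intCast_zmod_eq_zero_iff_dvd _ (p ^ k)).mpr (by exact_mod_cast hdvd)
  -- Step 3: transport from `σ₀` (a Frobenius at `𝔓₀ = 𝔓_{ι,𝔐}`) to `(𝔓, φ)`: `r φ = r σ₀`
  have h𝔓₀ : v.primeBelow ι 𝔐 ∈ v.primesAbove := primeBelow_mem_primesAbove h𝔐
  have hσ₀F : IsArithFrobAt (𝓞 ℚ) σ₀ (v.primeBelow ι 𝔐) := isArithFrobAt_resGalOfEmb h𝔐 ι hσL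
  obtain ⟨τ, hτ⟩ := exists_smul_eq_of_mem_primesAbove_holds h𝔓₀ h𝔓
  have hγ : IsArithFrobAt (𝓞 ℚ) (τ * σ₀ * τ⁻¹) 𝔓 := hτ ▸ hσ₀F.conj τ
  have hI : φ * (τ * σ₀ * τ⁻¹)⁻¹ ∈ 𝔓.inertia (absoluteGaloisGroup ℚ) := hφ.mul_inv_mem_inertia hγ
  have hrI : r (φ * (τ * σ₀ * τ⁻¹)⁻¹) = 1 :=
    cyclicCharacter_eq_one_of_mem_inertia W hP hr hgood hpkv h𝔓 hI
  have hrφ : r φ = r σ₀ := by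
    calc r φ = r (φ * (τ * σ₀ * τ⁻¹)⁻¹ * (τ * σ₀ * τ⁻¹)) := by rw [inv_mul_cancel_right]
      _ = r σ₀ := by rw [map_mul, hrI, one_mul, map_mul, map_mul, map_inv, mul_inv_cancel_comm]
  have hρ' : ((r σ₀ : (ZMod (p ^ k))ˣ) : ZMod (p ^ k)) = ((ρ : ℕ) : ZMod (p ^ k)) := by
    rw [hρ, ZMod.natCast_zmod_val]
  rw [hrφ, hρ']
  push_cast at hzero
  linear_combination hzero

/-- **A rational cyclic subgroup of prime-power order forces a root of the characteristic
polynomial of Frobenius modulo that order.** With notation as in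
`cyclicCharacter_sq_sub_frobeniusTrace_mul_add_eq_zero`: if `P` has order `pᵏ` and `Γ_ℚ` acts on
it through a character `r : Γ_ℚ → (ℤ/pᵏ)ˣ`, then for every prime `ℓ ≠ p` of good reduction the
polynomial `X² − a_ℓX + ℓ` has a root in `ℤ/pᵏ` (namely `r(φ)` for an arithmetic Frobenius `φ`
above `ℓ`, which exists: `primesAbove_nonempty`, `exists_isArithFrobAt_of_mem_primesAbove_holds`). This is the
shape refuted by the kernel-decided witnesses `noroot_…` of
`RationalIsogenyFrobeniusCertificates*.lean`. [cite: Mazur1978, §6 Prop. 6.3 (1) (p. 153)] -/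
theorem exists_root_charpoly_mod_of_cyclicCharacter (W : WeierstrassCurve ℚ)
    [W.IsElliptic] [W.IsGloballyMinimal] (p k ℓ : ℕ) [Fact p.Prime] [Fact ℓ.Prime] (hℓp : ℓ ≠ p)
    (hgoodℓ : W.HasGoodReductionAtPrime ℓ) {P : geomPoints W} (hP : addOrderOf P = p ^ k)
    {r : absoluteGaloisGroup ℚ →* (ZMod (p ^ k))ˣ}
    (hr : ∀ σ : absoluteGaloisGroup ℚ, σ • P = ((r σ : (ZMod (p ^ k))ˣ) : ZMod (p ^ k)).val • P) :
    ∃ t : ZMod (p ^ k), t ^ 2 - (W.frobeniusTrace ℓ : ZMod (p ^ k)) * t + (ℓ : ZMod (p ^ k)) = 0 := by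
  have hℓ : ℓ.Prime := Fact.out
  -- the place `v` of `ℚ` at `ℓ`, a prime `𝔓` of `\bar ℤ` above it and an arithmetic Frobenius `φ`
  set v : HeightOneSpectrum (𝓞 ℚ) :=
    (Rat.HeightOneSpectrum.primesEquiv (R := 𝓞 ℚ)).symm ⟨ℓ, hℓ⟩ with hvdef
  have hvℓ : (Rat.HeightOneSpectrum.primesEquiv v : ℕ) = ℓ := by
    rw [hvdef, Equiv.apply_symm_apply]
  have hv : (ℓ : 𝓞 ℚ) ∈ v.asIdeal := by
    rw [DeuringLadic.natCast_mem_asIdeal_iff v ℓ, hvℓ]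
  obtain ⟨𝔓, h𝔓⟩ := v.primesAbove_nonempty
  obtain ⟨φ, hφ⟩ := exists_isArithFrobAt_of_mem_primesAbove_holds (v := v) h𝔓
  exact ⟨_, cyclicCharacter_sq_sub_frobeniusTrace_mul_add_eq_zero W p k ℓ hℓp hgoodℓ hP hr hv h𝔓 hφ⟩

end Literature.NumberTheory.EllipticCurves.Mazur1978

end
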